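import Literature.Probability.RandomPlanarGeometry.SAWKestenCylinderRate
import HarnessLib

/-!
# Barrier (SAWScalingLimit): Kesten cylinder weights of `m`-step prefixes do not decay uniformly faster than `μ^{-m}`

Barrier catalogue `Literature/Barriers/CriticalPhenomena/` (D-0021), sub-problem `SAWScalingLimit`.
Technique class: a UNIFORM bound `P^B_m(q) ≤ C m^a μ^{-m}` on Kesten's infinite-bridge cylinder
weights (Madras–Slade §8.3, `kestenCyl d m q = Σ_k |E_k(q)| μ^{-k}`, Theorem 8.3.1 / eq. (8.3.6))
over ALL `m`-step self-avoiding prefixes `q`, with a polynomial correction `m^a`. Such a bound would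
make the irreducible-prefix one-arm estimates used in last-renewal decompositions uniform in the
prefix. It is FALSE for every `a < 0` and, at `a = 0`, for every `C < μ`: the straight prefix `E^m`
(`straightWalk d m : i ↦ (min i m)·e₀`, `SAWCount.lean`) has

  `kestenCyl d m (E^m) ≥ μ^{-(m-1)}`   (`one_div_pow_le_kestenCyl_straightWalk`),

so the cylinder weights of individual prefixes are not `o(μ^{-m})` uniformly — only their MEAN over
the `c_m` prefixes is (`Σ_{q ∈ S_m} P^B_m(q) = 1`, Madras–Slade §8.3). The bound with `a = 0` and
`C ≥ μ` is NOT excluded (not settled here: that is the surviving `a = 0`, `C ≥ μ` family of the lane).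

Proof of the witness: every irreducible bridge `τ` of length `k - (m-1) ≥ 1` starts with the step
`e₀` (`IsBridge` forces `τ(1)₀ > 0`), so `E^{m-1} ⧺ τ` is a `k`-step bridge extending `E^m` with no
renewal time in `[m, k)` (a renewal time `j ≥ m` would be the interior renewal time `j - (m-1)` of
`τ`); the gluing is injective, hence `|E_k(E^m)| ≥ λ_{k-m+1}` for `k ≥ m`, and summing against
`μ^{-k}` gives `Σ_k |E_k| μ^{-k} ≥ μ^{-(m-1)} Σ_{j ≥ 1} λ_j μ^{-j} = μ^{-(m-1)}` by Kesten's relation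
(`MadrasSlade1993_eq424_holds`, Madras–Slade (4.2.4)). Stated on `ℤ^{d+2}` because the convergence
of the cylinder series (`hasSum_kestenCyl`, Theorem 8.3.1) is in the tree in that generality.

[cite: MadrasSlade1993, §4.2, eq. (4.2.4) (p. 91); §8.3, Theorem 8.3.1, eqs. (8.3.6), (8.3.8)]
-/

open Finset Filter Literature.Probability.LatticeModels
open Literature.Probability.RandomPlanarGeometry.SAW
open Literature.Probability.RandomPlanarGeometry.SAW.Zd

namespace Literature.Barriers.CriticalPhenomena

namespace IrreduciblePrefixWitness

variable {d : ℕ} [NeZero d]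

/-- `straightWalk d m i = i·e₀` for `i ≤ m` (private helper). [folklore] -/
private theorem straightWalk_apply_of_le' {m i : ℕ} (hi : i ≤ m) :
    straightWalk d m i = Pi.single 0 (i : ℤ) := by
  simp [straightWalk, min_eq_left hi]

/-- The straight walk is a bridge (private helper; cf. `SAWTubeConnectors.straightWalk_mem_bridges`).
[folklore] -/
private theorem straightWalk_mem_bridges_kc (m : ℕ) : straightWalk d m ∈ bridges d m := by
  refine mem_bridges.2 ⟨straightWalk_mem_saws d m, fun i h1 hi => ?_⟩
  rw [straightWalk_apply_of_le' hi, straightWalk_apply_of_le' le_rfl]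
  simp only [straightWalk, Pi.single_eq_same]
  constructor
  · exact_mod_cast Nat.lt_of_lt_of_le Nat.zero_lt_one h1
  · exact_mod_cast hi

/-- The first step of a bridge (of length `≥ 1`) is `+e₀`. [cite: MadrasSlade1993, Definition 1.2.4] -/
theorem bridge_apply_one {n : ℕ} {τ : ℕ → Site d} (hn : 1 ≤ n) (hτ : τ ∈ bridges d n) :
    τ 1 = Pi.single 0 1 := by
  obtain ⟨hs, hb⟩ := mem_bridges.1 hτ
  obtain ⟨h0, -, hadj, -⟩ := mem_saws.1 hs
  have hpos : τ 0 0 < τ 1 0 := (hb 1 le_rfl hn).1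
  rw [h0] at hpos
  simp only [Pi.zero_apply] at hpos
  have := hadj 0 hn
  rw [zdGraph_adj_iff_sub, h0] at this
  obtain ⟨i, h | h⟩ := this
  · rw [sub_zero] at h
    by_cases hi : i = 0
    · subst hi; exact h
    · exfalso
      rw [h, Pi.single_apply] at hpos
      simp [Ne.symm hi] at hpos
  · exfalso
    rw [zero_sub] at h
    have h' : τ 1 = -Pi.single i 1 := by rw [← h, neg_neg]
    rw [h', Pi.neg_apply, Pi.single_apply] at hpos
    split_ifs at hpos <;> omega

/-- The gluing `τ ↦ E^{m-1} ⧺ τ` injects the irreducible bridges of length `k - (m-1)` into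
`E_k(E^m)`: `λ_{k-m+1} ≤ |E_k(E^m)|` for `k ≥ m ≥ 1` (the `i = m-1` term of the last-break-point
decomposition of Madras–Slade (8.3.8), restricted to the straight prefix).
[cite: MadrasSlade1993, §8.3, eq. (8.3.8) (p. 273); §1.2, eq. (1.2.15)] -/
theorem irreducibleBridgeCount_le_eCount_straightWalk {k m : ℕ} (hm : 1 ≤ m) (hmk : m ≤ k) :
    irreducibleBridgeCount d (k - (m - 1)) ≤ eCount d k m (straightWalk d m) := by
  classical
  set s := m - 1 with hs
  have hsk : s ≤ k := by omega
  have hη : straightWalk d s ∈ bridges d s := straightWalk_mem_bridges_kc s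
  have hηs : straightWalk d s ∈ saws d s := straightWalk_mem_saws d s
  unfold irreducibleBridgeCount eCount
  refine Finset.card_le_card_of_injOn (fun τ => concatWalk s (straightWalk d s) τ) ?_ ?_
  · intro τ hτ
    have hτb := irreducibleBridges_subset_bridges (k - s) hτ
    obtain ⟨-, hks, -, hirr⟩ := mem_irreducibleBridges.1 hτ
    have hτs := (mem_bridges.1 hτb).1
    have hτ0 := (mem_saws.1 hτs).1
    rw [Finset.mem_coe, Finset.mem_filter]
    refine ⟨concatWalk_mem_bridges hsk hη hτb, fun j hj => ?_, fun i hmi hik hren => ?_⟩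
    · show concatWalk s (straightWalk d s) τ j = straightWalk d m j
      rcases Nat.lt_or_ge j m with hjm | hjm
      · have hjs : j ≤ s := by omega
        rw [concatWalk_apply_of_le _ _ hjs, straightWalk_apply_of_le' hjs,
          straightWalk_apply_of_le' hj]
      · have hjm' : j = m := le_antisymm hj hjm
        have : m = s + 1 := by omega
        rw [hjm', this, concatWalk_apply_add _ _ hτ0, bridge_apply_one hks hτb,
          straightWalk_apply_of_le' le_rfl, straightWalk_apply_of_le' le_rfl, ← Pi.single_add]
        push_cast
        ring_nf
    · have h := (show IsRenewalTime k (concatWalk s (straightWalk d s) τ) i from hren).concatWalk_right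
        (by omega) hτ0 (mem_bridges.1 hτb).2
      exact hirr (i - s) (by omega) (by omega) h
  · intro τ hτ τ' hτ' h
    have hτs := (mem_bridges.1 (irreducibleBridges_subset_bridges (k - s) hτ)).1
    have hτ's := (mem_bridges.1 (irreducibleBridges_subset_bridges (k - s) hτ')).1
    exact (concatWalk_injective_pieces hηs hτs hηs hτ's h).2

/-- **`kestenCyl (E^m) ≥ μ^{-(m-1)}`** on `ℤ^{d+2}`, `m ≥ 1`: the witness killing every
`UniformPrefixCylinderPolyBound` with `a < 0` or `C < μ`.
[cite: MadrasSlade1993, §4.2, eq. (4.2.4) (p. 91); §8.3, Theorem 8.3.1, eq. (8.3.6)] -/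
theorem one_div_pow_le_kestenCyl_straightWalk (d : ℕ) {m : ℕ} (hm : 1 ≤ m) :
    1 / connectiveConstant (d + 2) ^ (m - 1) ≤ kestenCyl (d + 2) m (straightWalk (d + 2) m) := by
  set μ := connectiveConstant (d + 2) with hμdef
  have hμ : 0 < μ := connectiveConstant_pos (d + 2)
  have hf : HasSum (fun k => (eCount (d + 2) k m (straightWalk (d + 2) m) : ℝ) / μ ^ k)
      (kestenCyl (d + 2) m (straightWalk (d + 2) m)) :=
    hasSum_kestenCyl hm (straightWalk_mem_saws (d + 2) m)
  -- the shifted Kesten series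
  set g : ℕ → ℝ := fun k =>
    if m ≤ k then (irreducibleBridgeCount (d + 2) (k - (m - 1)) : ℝ) / μ ^ k else 0 with hgdef
  have hK : HasSum (fun j : ℕ => (irreducibleBridgeCount (d + 2) j : ℝ) / μ ^ j) 1 :=
    MadrasSlade1993_eq424_holds (d + 2)
  have hK' : HasSum (fun j : ℕ => (irreducibleBridgeCount (d + 2) j : ℝ) / μ ^ j / μ ^ (m - 1))
      (1 / μ ^ (m - 1)) := hK.div_const _
  have hshift : (fun n => g (n + (m - 1))) =
      fun j : ℕ => (irreducibleBridgeCount (d + 2) j : ℝ) / μ ^ j / μ ^ (m - 1) := by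
    funext n
    simp only [hgdef]
    rcases Nat.eq_zero_or_pos n with rfl | hn
    · have : ¬ m ≤ 0 + (m - 1) := by omega
      simp only [if_neg this, irreducibleBridgeCount_zero, Nat.cast_zero, zero_div]
    · have h1 : m ≤ n + (m - 1) := by omega
      have h2 : n + (m - 1) - (m - 1) = n := by omega
      rw [if_pos h1, h2, pow_add, div_div]
  have hg : HasSum g (1 / μ ^ (m - 1)) := by
    rw [← hasSum_nat_add_iff' (m - 1), hshift]
    have hzero : ∑ i ∈ Finset.range (m - 1), g i = 0 := by
      refine Finset.sum_eq_zero fun i hi => ?_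
      have : ¬ m ≤ i := by have := Finset.mem_range.1 hi; omega
      simp [hgdef, this]
    rw [hzero, sub_zero]
    exact hK'
  refine hasSum_le (fun k => ?_) hg hf
  simp only [hgdef]
  split_ifs with hk
  · exact div_le_div_of_nonneg_right
      (by exact_mod_cast irreducibleBridgeCount_le_eCount_straightWalk hm hk) (pow_pos hμ k).le
  · positivity


/-- `X / μ^m < 1 / μ^{m-1}` whenever `X / μ < 1`, `m ≥ 1` (private helper). [folklore] -/
private theorem div_pow_lt_one_div_pow {μ X : ℝ} (hμ : 0 < μ) {m : ℕ} (hm : 1 ≤ m)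
    (hX : X / μ < 1) : X / μ ^ m < 1 / μ ^ (m - 1) := by
  obtain ⟨n, rfl⟩ : ∃ n, m = n + 1 := ⟨m - 1, by omega⟩
  rw [Nat.add_sub_cancel]
  have h1 : X / μ ^ (n + 1) = (X / μ) / μ ^ n := by
    rw [pow_succ, div_div, mul_comm]
  rw [h1, div_lt_div_iff_of_pos_right (pow_pos hμ n)]
  exact hX

end IrreduciblePrefixWitness

open IrreduciblePrefixWitness

/-- **Technique class.** A uniform polynomial-corrected bound on Kesten's cylinder weights of ALL
`m`-step self-avoiding prefixes: `P^B_m(q) ≤ C · m^a · μ^{-m}` for every `m ≥ 1` and every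
`q ∈ S_m` (`kestenCyl d m q = Σ_k |E_k(q)| μ^{-k}`, Madras–Slade (8.3.6); real exponent `a`).
[cite: MadrasSlade1993, §8.3, Theorem 8.3.1, eq. (8.3.6)] -/
def UniformPrefixCylinderPolyBound (d : ℕ) [NeZero d] (C a : ℝ) : Prop :=
  ∀ m : ℕ, 1 ≤ m → ∀ q ∈ saws d m,
    kestenCyl d m q ≤ C * (m : ℝ) ^ a / connectiveConstant d ^ m

/-- No uniform prefix bound with `C < μ` (any exponent `a`): already `m = 1` fails, since
`kestenCyl 1 (E) = 1 > C/μ` (every bridge starts with `e₀`).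
[cite: MadrasSlade1993, §4.2, eq. (4.2.4) (p. 91); §8.3, Theorem 8.3.1, eq. (8.3.6)] -/
theorem not_uniformPrefixCylinderPolyBound_of_lt_connectiveConstant (d : ℕ) {C a : ℝ}
    (hC : C < connectiveConstant (d + 2)) : ¬ UniformPrefixCylinderPolyBound (d + 2) C a := by
  intro h
  have hμ : 0 < connectiveConstant (d + 2) := connectiveConstant_pos (d + 2)
  have h1 := h 1 le_rfl (straightWalk (d + 2) 1) (straightWalk_mem_saws (d + 2) 1)
  have h2 := one_div_pow_le_kestenCyl_straightWalk d (le_refl 1)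
  simp only [Nat.cast_one, Real.one_rpow, mul_one, pow_one] at h1
  simp only [Nat.sub_self, pow_zero, div_one] at h2
  have : C / connectiveConstant (d + 2) < 1 := (div_lt_one hμ).2 hC
  linarith

/-- No uniform prefix bound with a negative polynomial exponent `a < 0`, whatever `C`: for large
`m`, `C m^a < μ` and the straight prefix `E^m` has `kestenCyl (E^m) ≥ μ^{-(m-1)} > C m^a μ^{-m}`.
[cite: MadrasSlade1993, §4.2, eq. (4.2.4) (p. 91); §8.3, Theorem 8.3.1, eq. (8.3.6)] -/
theorem not_uniformPrefixCylinderPolyBound_of_neg (d : ℕ) {C a : ℝ} (ha : a < 0) :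
    ¬ UniformPrefixCylinderPolyBound (d + 2) C a := by
  intro h
  set μ := connectiveConstant (d + 2) with hμdef
  have hμ : 0 < μ := connectiveConstant_pos (d + 2)
  -- choose `m ≥ 1` with `C / μ < m^{-a}`
  have hlim : Tendsto (fun n : ℕ => (n : ℝ) ^ (-a)) atTop atTop :=
    (tendsto_rpow_atTop (neg_pos.2 ha)).comp tendsto_natCast_atTop_atTop
  obtain ⟨M, hM⟩ := Filter.eventually_atTop.1 (hlim.eventually_gt_atTop (C / μ))
  set m := max M 1 with hmdef
  have hm1 : 1 ≤ m := le_max_right _ _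
  have hbig : C / μ < (m : ℝ) ^ (-a) := hM m (le_max_left _ _)
  have hmpos : (0 : ℝ) < m := by exact_mod_cast hm1
  have hma : 0 < (m : ℝ) ^ a := Real.rpow_pos_of_pos hmpos a
  have key : C * (m : ℝ) ^ a / μ < 1 := by
    rw [Real.rpow_neg hmpos.le] at hbig
    have h' : C < ((m : ℝ) ^ a)⁻¹ * μ := (div_lt_iff₀ hμ).1 hbig
    rw [div_lt_iff₀ hμ, one_mul]
    calc C * (m : ℝ) ^ a < ((m : ℝ) ^ a)⁻¹ * μ * (m : ℝ) ^ a :=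
          mul_lt_mul_of_pos_right h' hma
      _ = μ := by rw [mul_comm (((m : ℝ) ^ a)⁻¹) μ, inv_mul_cancel_right₀ hma.ne']
  have h1 := h m hm1 (straightWalk (d + 2) m) (straightWalk_mem_saws (d + 2) m)
  have h2 := one_div_pow_le_kestenCyl_straightWalk d hm1
  exact absurd (lt_of_le_of_lt h1 (div_pow_lt_one_div_pow hμ hm1 key)) (not_lt.2 h2)

/-- **BARRIER.** For every dimension `d + 2`, every constant `C` and every exponent `a`: if `a < 0`,
or if `C < μ`, then no uniform bound `P^B_m(q) ≤ C m^a μ^{-m}` over all `m`-step prefixes `q` holds.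
Negative knowledge for the polynomial-prefix («IRR-PREFIX(C, a)») bound family: the only surviving
members have `a ≥ 0`, and at `a = 0` need `C ≥ μ`.

BARRIER (structured block, D-0021):
- technique_class: kesten-bridge-measure cylinder-weight uniform-prefix-bound irreducible-prefix polynomial-decay — explicitly the predicate `UniformPrefixCylinderPolyBound d C a` (`∀ m ≥ 1, ∀ q ∈ S_m, kestenCyl d m q ≤ C m^a μ^{-m}`)
- blocks: importing a prefix-uniform decay `P^B_m(q) = o(μ^{-m})` (or `O(m^a μ^{-m})`, `a < 0`) of Kesten's cylinder weights as the un-weighting input of last-renewal / irreducible-prefix one-arm estimates (route `SAWRenewalTightness`, item `IrreduciblePrefixOneArm`: "un-weighting prefix vs completed piece") — only the mean `Σ_{q ∈ S_m} P^B_m(q) = 1` over the `c_m ≈ μ^m` prefixes decays like `μ^{-m}` [cite: MadrasSlade1993, §8.3, eqs. (8.3.4)–(8.3.6)]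
- because: the straight prefix `E^m` carries weight `≥ μ^{-(m-1)}` (`one_div_pow_le_kestenCyl_straightWalk`: the event "the first `m-1` irreducible pieces are single `e₀`-steps" has Kesten weight `μ^{-(m-1)}` by `λ_1 = 1` and Kesten's relation `Σ λ_k μ^{-k} = 1`, and the `m`-th piece starts with `e₀`), which beats `C m^a μ^{-m}` at `m = 1` when `C < μ` and for all large `m` when `a < 0` [cite: MadrasSlade1993, §4.2, eq. (4.2.4) (p. 91)]
- evasions_known: bounds AVERAGED over prefixes (the normalisation itself), bounds restricted to prefix classes excluding the straight / few-piece prefixes (e.g. prefixes with `≥ δm` renewal times, or with a transversal displacement `≥ m^{ν}`), bounds with `a ≥ 0` and `C ≥ μ` (not excluded here; `a = 0, C = μ` is the trivial `P^B_m(q) ≤ 1`-type shape only for `m = 1`), and bounds on the bridge-cylinder probabilities `P^B_{m,n}(q)` at FINITE `n` with `n`-dependent constants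
- scope_caveats: EXCLUDED is exactly `UniformPrefixCylinderPolyBound (d+2) C a` with `a < 0` (any real `C`) or `C < μ(d+2)` (any real `a`), on `ℤ^{d+2}`, `d ≥ 0`, for the tree's `kestenCyl` (`Σ_k |E_k(q)| μ^{-k}`, `eCount` = bridges extending `q` with no renewal time in `[m, k)`); nothing is said about `a ≥ 0` with `C ≥ μ`, about other prefix-uniform functionals (e.g. `kestenCyl d m q ≤ C μ^{-m} · (number of renewal times of q)^{-1}`), or about the half-space / pulled measures
- status: established — `NoUniformIrreduciblePrefixDecay_holds` (this file), witness `straightWalk`, kernel-checked; no printed source states the uniform bound or its failure (the refuting computation is elementary from Madras–Slade (4.2.4) and (8.3.6)–(8.3.8))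
[cite: MadrasSlade1993, §4.2, eq. (4.2.4) (p. 91); §8.3, Theorem 8.3.1, eqs. (8.3.6), (8.3.8)] -/
def NoUniformIrreduciblePrefixDecay : Prop :=
  ∀ (d : ℕ) (C a : ℝ), a < 0 ∨ C < connectiveConstant (d + 2) →
    ¬ UniformPrefixCylinderPolyBound (d + 2) C a

/-- **The barrier statement holds.**
[cite: MadrasSlade1993, §4.2, eq. (4.2.4) (p. 91); §8.3, Theorem 8.3.1, eq. (8.3.6)] -/
theorem NoUniformIrreduciblePrefixDecay_holds : NoUniformIrreduciblePrefixDecay := by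
  intro d C a h
  rcases h with ha | hC
  · exact not_uniformPrefixCylinderPolyBound_of_neg d ha
  · exact not_uniformPrefixCylinderPolyBound_of_lt_connectiveConstant d hC

end Literature.Barriers.CriticalPhenomena
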